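import Summits.BirchSwinnertonDyer.BirchSwinnertonDyer.Theorems.PrintCf2SplitBadTwoCMShaDescentInjective
import Literature.NumberTheory.EllipticCurves.ShaRestrictionJZeroInvariants
import HarnessLib

/-!
# Crux `PrintCf2.SplitBadTwoRankOneOfFacts` (item stmt-BirchSwinnertonDyer-20368), road α over the CM field:
# `res : H¹(ℚ, E) ⥲ H¹(K, E_K)^{Gal(K/ℚ)}` is a BIJECTION onto the invariants for `j = −3375`, `K = ℚ(√−7)`
# (trace-ONE corestriction: `res ∘ cor ∘ π_* = id` on the invariants)

Cell `bsd-print-cf2`, width seat `bsd-line-cf2-p1-w8` g0 (brick **B6d**, sequel of B6c); `--supports stmt-BirchSwinnertonDyer-20368`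
(helper). HONEST FRAMING: nothing here closes a crux or a stub; BSD is not proved by any of this; no summit statement is proved by
this seat. No definition is introduced. beyond-print theorem: no.

THE MECHANISM (the `ℤ[(1+√−7)/2]` twin of the tree's `JZero.exists_resBaseChange_eq_of_conjH1Points_eq`, which does `ℤ[ω]` with
`res ∘ cor ∘ (−[ω]_*)`): for the index-`2` open normal subgroup `N = Γ_K ≤ Γ_ℚ` and `c ∉ N` one has `res (cor y) = y + c_* y`
(the tree's `resSubgroupH1_corH1`). If `ψ` is an `N`-equivariant endomorphism of the coefficients with the TRACE-ONE semilinearity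
`c • ψ m = c • m − ψ (c • m)` (`c ψ c⁻¹ = 1 − ψ`; the complex multiplication `π = [(1+√−7)/2]`, B6c `smul_cmEndo_eq_of_coset`), then
for a `c_*`-invariant class `ξ`: `res (cor (ψ_* ξ)) = ψ_* ξ + c_* ψ_* ξ = ψ_* ξ + (c_* ξ − ψ_* c_* ξ) = ξ`. No `2`-invertibility; the
generic index-`2` corestriction only gives `cor ∘ res = 2`.

* §1 (generic, subgroup model): `conjH1_resH1Hom_id_of_traceOne` (`c_* ψ_* = c_* − ψ_* c_*` on `H¹(N, M)`),
  **`exists_resSubgroupH1_eq_of_conjH1_eq_of_traceOne`** (invariant classes are restrictions), `range_resSubgroupH1_eq_of_traceOne`.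
* §2 (`E = W/ℚ`, `j = −3375`, `[K:ℚ] = 2`, `θ² = −7`, `σ₀ ≠ 1`): `exists_resSubgroupH1_eq_of_conjH1_eq_cm` (subgroup model with
  `N = galRange K`, `c = liftToAbsGal K σ₀`, `ψ = π₀` of B6c `exists_cmEndo_commute_galRange`).
* §3 transport to the tree's `resBaseChange` / `IsLiftOfAut.conjH1Points` (verbatim the model isomorphism of
  `JZero.exists_resBaseChange_eq_of_conjH1Points_eq`): **`exists_resBaseChange_eq_of_conjH1Points_eq_cm`**,
  **`range_resBaseChange_eq_cm`** (`res(H¹(ℚ, E)) = H¹(K, E_K)^{τ}` for the chosen lift `τ = liftAut σ₀`), and with B6c's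
  injectivity **`existsUnique_resBaseChange_eq_of_conjH1Points_eq_cm`**: `res : H¹(ℚ, E) ⥲ H¹(K, E_K)^{τ}` is a bijection.
* NOT here: the local descent `Ш(E/ℚ) = res⁻¹ Ш(E_K/K)` (the `JZero.mem_sha_of_resBaseChange_mem_sha_rat` twin), which would upgrade
  §3 to `res : Ш(E/ℚ) ⥲ Ш(E_K/K)^{τ}` and, with B6b, to `#Ш(E_K/K)[2^∞] = (#Ш(E/ℚ)[2^∞])²` exactly.

References: J.-P. Serre, *Galois Cohomology*, I.§2.4 (Prop. 9 and Cor.), I.§2.5, I.§5.8; J. Neukirch, A. Schmidt, K. Wingberg,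
*Cohomology of Number Fields*, I.§5; B. H. Gross, LMS LNS 153 (1991) §5 (5.1)–(5.2).
-/

noncomputable section

open scoped Classical

set_option linter.dupNamespace false
set_option autoImplicit false

namespace Summit.BirchSwinnertonDyer.BirchSwinnertonDyer.Theorems.PrintCf2.CMPrimes

open WeierstrassCurve Literature.NumberTheory.EllipticCurves Literature.NumberTheory.GaloisRepresentations Field NumberField
open Summit.BirchSwinnertonDyer.BirchSwinnertonDyer.Theorems

universe u

/-! ## §1 Trace-one corestriction on continuous `H¹` along an open normal subgroup of index `2` -/

section TraceOne

variable {G : Type u} [Group G] [TopologicalSpace G] [IsTopologicalGroup G]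
variable {N : Subgroup G} [N.Normal] {c : G}
variable {M : Type u} [AddCommGroup M] [DistribMulAction G M] [TopologicalSpace M] [DiscreteTopology M]

/-- **Trace-one semilinearity on `H¹`.** Let `ψ : M →+ M` be `N`-equivariant with `c • ψ m = c • m − ψ (c • m)` (`c ψ c⁻¹ = 1 − ψ`).
Then on `H¹(N, M)`: `c_* (ψ_* ξ) = c_* ξ − ψ_* (c_* ξ)` (`ψ_* = resH1Hom id ψ`, `c_* = conjH1 N M c`); on cocycles both sides are
`n ↦ c • ψ (f (c⁻¹ n c))`. [cite: SerreGaloisCohomology1997, I.§2.4 (Prop. 9 and Cor.) and I.§5.8] -/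
theorem conjH1_resH1Hom_id_of_traceOne (ψ : M →+ M)
    (hψ : ∀ (n : N) (m : M), ψ (ContinuousMonoidHom.id N n • m) = n • ψ m)
    (hψc : ∀ m : M, c • ψ m = c • m - ψ (c • m)) (ξ : subgroupH1 N M) :
    conjH1 N M c (resH1Hom (ContinuousMonoidHom.id N) ψ hψ ξ) =
      conjH1 N M c ξ - resH1Hom (ContinuousMonoidHom.id N) ψ hψ (conjH1 N M c ξ) := by
  obtain ⟨f, rfl⟩ := oneCocycleClass_surjective _ ξ
  rw [resH1Hom_oneCocycleClass, conjH1_oneCocycleClass, conjH1_oneCocycleClass, resH1Hom_oneCocycleClass,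
    ← oneCocycleClass_sub]
  congr 1
  apply Subtype.ext
  ext n
  exact hψc _

/-- **TRACE-ONE CORESTRICTION: invariant classes are restrictions.** Let `N ≤ G` be an open normal subgroup of index `2`
(`G = N ⊔ N c`), `M` a discrete `G`-module (continuous orbit maps), `ψ : M →+ M` `N`-equivariant with `c • ψ m = c • m − ψ (c • m)`.
Then every `ξ ∈ H¹(N, M)` with `c_* ξ = ξ` is a restriction: `res (cor (ψ_* ξ)) = ψ_* ξ + c_* ψ_* ξ = ψ_* ξ + ξ − ψ_* ξ = ξ`
(`resSubgroupH1_corH1`: `res ∘ cor = 1 + c_*`). [cite: SerreGaloisCohomology1997, I.§2.4 (Prop. 9 and Cor.) and I.§5.8]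
[cite: NeukirchSchmidtWingberg2008, I.§5] -/
theorem exists_resSubgroupH1_eq_of_conjH1_eq_of_traceOne (hN : IsOpen (N : Set G))
    (hM : ∀ m : M, Continuous fun g : G ↦ g • m) (hc : ∀ b : G, Xor (b * c⁻¹ ∈ N) (b ∈ N))
    (ψ : M →+ M) (hψ : ∀ (n : N) (m : M), ψ (ContinuousMonoidHom.id N n • m) = n • ψ m)
    (hψc : ∀ m : M, c • ψ m = c • m - ψ (c • m)) {ξ : subgroupH1 N M} (hξ : conjH1 N M c ξ = ξ) :
    ∃ η : discreteH1 G M, resSubgroupH1 N M η = ξ := by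
  refine ⟨corH1 hN hM hc (resH1Hom (ContinuousMonoidHom.id N) ψ hψ ξ), ?_⟩
  rw [resSubgroupH1_corH1, conjH1_resH1Hom_id_of_traceOne ψ hψ hψc, hξ]
  abel

/-- **`res` maps ONTO the `c_*`-invariants** (set form) under the hypotheses of
`exists_resSubgroupH1_eq_of_conjH1_eq_of_traceOne`. [cite: SerreGaloisCohomology1997, I.§2.4 (Prop. 9 and Cor.) and I.§5.8] -/
theorem range_resSubgroupH1_eq_of_traceOne (hN : IsOpen (N : Set G))
    (hM : ∀ m : M, Continuous fun g : G ↦ g • m) (hc : ∀ b : G, Xor (b * c⁻¹ ∈ N) (b ∈ N))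
    (ψ : M →+ M) (hψ : ∀ (n : N) (m : M), ψ (ContinuousMonoidHom.id N n • m) = n • ψ m)
    (hψc : ∀ m : M, c • ψ m = c • m - ψ (c • m)) :
    ((resSubgroupH1 N M).range : Set (subgroupH1 N M)) = {ξ | conjH1 N M c ξ = ξ} := by
  ext ξ
  simp only [SetLike.mem_coe, AddMonoidHom.mem_range, Set.mem_setOf_eq]
  constructor
  · rintro ⟨η, rfl⟩
    exact conjH1_resSubgroupH1 N hM c η
  · exact fun hξ ↦ exists_resSubgroupH1_eq_of_conjH1_eq_of_traceOne hN hM hc ψ hψ hψc hξ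

end TraceOne

/-! ## §2 The subgroup model for `E = W/ℚ`, `j = −3375`, `N = galRange K`, `c = liftToAbsGal K σ₀`, `ψ = π₀` -/

section SubgroupModel

variable (W : WeierstrassCurve ℚ) [W.IsElliptic] (K : Type) [Field K] [NumberField K]

/-- **INVARIANT CLASSES ARE RESTRICTIONS (subgroup model)** for `E = W/ℚ` with `j = −3375` and `K` a quadratic number field with
`θ² = −7`, `σ₀ ∈ Aut(K/ℚ)`, `σ₀ ≠ 1`: every `ξ ∈ H¹(galRange K, E(ℚ̄))` with `c_* ξ = ξ`, `c = liftToAbsGal K σ₀`, is the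
restriction of a class of `H¹(ℚ, E)` — by the trace-one corestriction with `ψ = π₀` (B6c `exists_cmEndo_commute_galRange`:
`π₀` commutes with `galRange K`; `smul_cmEndo_eq_of_coset`: `c π₀ c⁻¹ = 1 − π₀`).
[cite: SerreGaloisCohomology1997, I.§2.4 (Prop. 9 and Cor.) and I.§5.8] [cite: SilvermanATAEC1994, II §2 Thm. 2.2(b)] -/
theorem exists_resSubgroupH1_eq_of_conjH1_eq_cm (hj : W.j = -3375) (h2 : Module.finrank ℚ K = 2) {θ : K}
    (hθ : θ ^ 2 = -7) {σ₀ : K ≃ₐ[ℚ] K} (hσ₀ : σ₀ ≠ 1) [(galRange (K := ℚ) K).Normal]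
    {ξ : subgroupH1 (galRange (K := ℚ) K) (geomPoints W)}
    (hξ : conjH1 (galRange (K := ℚ) K) (geomPoints W) (liftToAbsGal (K := ℚ) K σ₀) ξ = ξ) :
    ∃ η : W.galH1, resSubgroupH1 (galRange (K := ℚ) K) (geomPoints W) η = ξ := by
  haveI : IsGalois ℚ K := by
    haveI : Algebra.IsQuadraticExtension ℚ K := ⟨h2⟩
    infer_instance
  have hN : IsOpen (galRange (K := ℚ) K : Set (Field.absoluteGaloisGroup ℚ)) := isOpen_galRange K
  have hM : ∀ m : geomPoints W, Continuous fun g : Field.absoluteGaloisGroup ℚ ↦ g • m := fun P ↦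
    continuous_smul_of_isOpen_stabilizer P (isOpen_stabilizer_point_holds W P)
  have hc := xor_galRange K h2 hσ₀
  obtain ⟨π₀, hπ₀, hrel₀, -, hcommN⟩ := exists_cmEndo_commute_galRange W K hj hθ
  have hcoset : ∀ g : Field.absoluteGaloisGroup ℚ,
      g ∈ galRange (K := ℚ) K ∨ g * (liftToAbsGal (K := ℚ) K σ₀)⁻¹ ∈ galRange (K := ℚ) K := fun g ↦ by
    rcases hc g with ⟨h1, -⟩ | ⟨h1, -⟩
    · exact Or.inr h1
    · exact Or.inl h1
  have hanti := smul_cmEndo_eq_of_coset W hπ₀ hrel₀ hcommN hcoset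
  -- `ψ = π₀` as a homomorphism
  let ψ : geomPoints W →+ geomPoints W :=
    { toFun := fun P ↦ π₀ P, map_zero' := map_zero π₀, map_add' := map_add π₀ }
  have hψ : ∀ (n : galRange (K := ℚ) K) (m : geomPoints W),
      ψ (ContinuousMonoidHom.id (galRange (K := ℚ) K) n • m) = n • ψ m := fun n m ↦
    (hcommN n n.2 m).symm
  have hψc : ∀ m : geomPoints W,
      liftToAbsGal (K := ℚ) K σ₀ • ψ m = liftToAbsGal (K := ℚ) K σ₀ • m - ψ (liftToAbsGal (K := ℚ) K σ₀ • m) :=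
    fun m ↦ hanti m
  exact exists_resSubgroupH1_eq_of_conjH1_eq_of_traceOne hN hM hc ψ hψ hψc hξ

end SubgroupModel

/-! ## §3 Transport to the tree's `resBaseChange` and `IsLiftOfAut.conjH1Points` -/

section Transport

variable (K : Type) [Field K] [NumberField K] (W : WeierstrassCurve ℚ) [W.IsElliptic]

/-- **INVARIANT CLASSES OF `H¹(K, E_K)` ARE RESTRICTIONS** for `E = W/ℚ` with `j = −3375`, `K` a quadratic number field with
`θ² = −7`, `σ ∈ Aut(K/ℚ)` non-trivial and `τ = liftAut σ` its chosen lift: every `s ∈ H¹(K, E_K)` with `τ_* s = s` is `res c` for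
some `c ∈ H¹(ℚ, E)`. The model isomorphism `Φ : H¹(Γ_K, E_K(K̄)) → H¹(galRange K, E(ℚ̄))` (pair `(rangeToResGal, θ⁻¹)`, injective,
`Φ ∘ res = resSubgroupH1`, `Φ ∘ τ_* = c_* ∘ Φ` with `c = liftToAbsGal K σ`) is VERBATIM that of
`JZero.exists_resBaseChange_eq_of_conjH1Points_eq`; the input is §2. [cite: SerreGaloisCohomology1997, I.§2.4 (Prop. 9 and Cor.) and I.§5.8]
[cite: GrossLMS1991, §5 (5.1)] -/
theorem exists_resBaseChange_eq_of_conjH1Points_eq_cm (hj : W.j = -3375) (h2 : Module.finrank ℚ K = 2) {θ : K}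
    (hθ : θ ^ 2 = -7) {σ : K ≃ₐ[ℚ] K} (hσ1 : σ ≠ 1) {s : (W.baseChange K).galH1}
    (hs : (isLiftOfAut_liftAut σ).conjH1Points W s = s) :
    ∃ c : W.galH1, resBaseChange W K c = s := by
  haveI : IsGalois ℚ K := by
    haveI : Algebra.IsQuadraticExtension ℚ K := ⟨h2⟩
    infer_instance
  haveI hNn : (galRange (K := ℚ) K).Normal := normal_galRange K h2 hσ1
  -- the coefficient isomorphism `θ : E(ℚ̄) ≃ E_K(K̄)` (the chosen embedding on coordinates)
  have hθ₀ : Function.Bijective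
      ((localPointsEquivGeomPoints W K).toAddMonoidHom.comp (pointsMap W K)) :=
    (localPointsEquivGeomPoints W K).bijective.comp
      (pointsMapOfEmb_bijective K W (closureEmb (K := ℚ) K))
  obtain ⟨Θ, hΘ⟩ : ∃ Θ : geomPoints W ≃+ geomPoints (W.baseChange K),
      ∀ P, Θ P = localPointsEquivGeomPoints W K (pointsMap W K P) :=
    ⟨AddEquiv.ofBijective _ hθ₀, fun _ ↦ rfl⟩
  have hΘ_smul : ∀ (g : Field.absoluteGaloisGroup K) (P : geomPoints W),
      Θ (resGal (K := ℚ) K g • P) = g • Θ P := fun g P ↦ by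
    rw [hΘ, hΘ, pointsMap_smul, localPointsEquivGeomPoints_smul]
  have hΘ_symm_smul : ∀ (n : galRange (K := ℚ) K) (Q : geomPoints (W.baseChange K)),
      Θ.symm (rangeToResGal (K := ℚ) K n • Q) = n • Θ.symm Q := fun n Q ↦ by
    apply Θ.injective
    rw [AddEquiv.apply_symm_apply]
    have e : Θ (n • Θ.symm Q) = Θ (resGal (K := ℚ) K (rangeToResGal (K := ℚ) K n) • Θ.symm Q) := by
      rw [resGal_rangeToResGal]
      rfl
    rw [e, hΘ_smul, AddEquiv.apply_symm_apply]
  have hΘ_c : ∀ Q : geomPoints W,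
      Θ (liftToAbsGal (K := ℚ) K σ • Q) = (isLiftOfAut_liftAut σ).pointsMap W (Θ Q) := fun Q ↦ by
    rw [hΘ, hΘ]
    exact localPointsEquivGeomPoints_pointsMap_smul W σ Q
  -- the model isomorphism `Φ` and its left inverse `Ψ`
  obtain ⟨Φ, hΦ⟩ : ∃ Φ : (W.baseChange K).galH1 →+ subgroupH1 (galRange (K := ℚ) K) (geomPoints W),
      Φ = resH1Hom (rangeToResGal (K := ℚ) K) Θ.symm.toAddMonoidHom hΘ_symm_smul := ⟨_, rfl⟩
  have hΨ_smul : ∀ (g : Field.absoluteGaloisGroup K) (P : geomPoints W),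
      Θ (resGalToRange (K := ℚ) K g • P) = g • Θ P := fun g P ↦ hΘ_smul g P
  obtain ⟨Ψ, hΨ⟩ : ∃ Ψ : subgroupH1 (galRange (K := ℚ) K) (geomPoints W) →+ (W.baseChange K).galH1,
      Ψ = resH1Hom (resGalToRange (K := ℚ) K) Θ.toAddMonoidHom hΨ_smul := ⟨_, rfl⟩
  have hΨΦ : ∀ x, Ψ (Φ x) = x := fun x ↦ by
    rw [hΦ, hΨ, resH1Hom_resH1Hom]
    have e : resH1Hom ((rangeToResGal (K := ℚ) K).comp (resGalToRange (K := ℚ) K))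
        (Θ.toAddMonoidHom.comp Θ.symm.toAddMonoidHom)
        (fun x m ↦ by
          simp only [AddMonoidHom.coe_comp, Function.comp_apply, ContinuousMonoidHom.comp_toFun,
            AddEquiv.coe_toAddMonoidHom, hΘ_symm_smul, hΨ_smul]) =
          resH1Hom (ContinuousMonoidHom.id _) (AddMonoidHom.id _) (fun _ _ ↦ rfl) :=
      resH1Hom_congr (by ext g; exact rangeToResGal_resGalToRange K g)
        (by ext Q; exact Θ.apply_symm_apply Q) _ _
    rw [e, resH1Hom_id]
    rfl
  -- `Φ ∘ res = resSubgroupH1`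
  have hΦres : ∀ η : W.galH1,
      Φ (resBaseChange W K η) = resSubgroupH1 (galRange (K := ℚ) K) (geomPoints W) η := fun η ↦ by
    rw [hΦ]
    change resH1Hom (rangeToResGal (K := ℚ) K) Θ.symm.toAddMonoidHom hΘ_symm_smul
      (h1Equiv (localPointsEquivGeomPoints W K) (localPointsEquivGeomPoints_smul W K)
        (resH1Hom (resGal (K := ℚ) K) (pointsMap W K) (pointsMap_smul W K) η)) = _
    rw [h1Equiv_apply, resH1Hom_resH1Hom, resH1Hom_resH1Hom]
    have hG : ((resGal (K := ℚ) K).comp (ContinuousMonoidHom.id _)).comp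
        (rangeToResGal (K := ℚ) K) = Literature.NumberTheory.EllipticCurves.subgroupIncl (galRange (K := ℚ) K) := by
      apply ContinuousMonoidHom.ext
      intro n
      exact resGal_rangeToResGal K n
    have hM : (Θ.symm.toAddMonoidHom.comp
        ((localPointsEquivGeomPoints W K : localPoints W K →+ geomPoints (W.baseChange K)).comp
          (pointsMap W K))) = AddMonoidHom.id (geomPoints W) := by
      refine AddMonoidHom.ext fun P ↦ ?_
      apply Θ.injective
      change Θ (Θ.symm (localPointsEquivGeomPoints W K (pointsMap W K P))) = Θ P
      rw [AddEquiv.apply_symm_apply, hΘ]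
    exact congrFun (congrArg DFunLike.coe (resH1Hom_congr hG hM _ _)) η
  -- `Φ ∘ τ_* = c_* ∘ Φ`
  have hΦconj : ∀ x : (W.baseChange K).galH1,
      Φ ((isLiftOfAut_liftAut σ).conjH1Points W x) =
        conjH1 (galRange (K := ℚ) K) (geomPoints W) (liftToAbsGal (K := ℚ) K σ) (Φ x) := fun x ↦ by
    have hG : ((isLiftOfAut_liftAut σ).conjGalCMH).comp (rangeToResGal (K := ℚ) K) =
        (rangeToResGal (K := ℚ) K).comp
          (subgroupConj (galRange (K := ℚ) K) (liftToAbsGal (K := ℚ) K σ)) := by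
      apply ContinuousMonoidHom.ext
      intro n
      apply resGal_injective (K := ℚ) K
      change resGal (K := ℚ) K ((isLiftOfAut_liftAut σ).conjGalCMH (rangeToResGal (K := ℚ) K n)) =
        resGal (K := ℚ) K (rangeToResGal (K := ℚ) K
          (subgroupConj (galRange (K := ℚ) K) (liftToAbsGal (K := ℚ) K σ) n))
      rw [resGal_conjGalCMH, resGal_rangeToResGal, resGal_rangeToResGal, subgroupConj_apply_coe]
    have hM : (Θ.symm.toAddMonoidHom).comp ((isLiftOfAut_liftAut σ).pointsMap W) =
        (DistribSMul.toAddMonoidHom (geomPoints W) (liftToAbsGal (K := ℚ) K σ)).comp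
          Θ.symm.toAddMonoidHom := by
      refine AddMonoidHom.ext fun m ↦ ?_
      apply Θ.injective
      change Θ (Θ.symm ((isLiftOfAut_liftAut σ).pointsMap W m)) =
        Θ (liftToAbsGal (K := ℚ) K σ • Θ.symm m)
      rw [AddEquiv.apply_symm_apply, hΘ_c, AddEquiv.apply_symm_apply]
    rw [hΦ, IsLiftOfAut.conjH1Points, Literature.NumberTheory.EllipticCurves.conjH1, resH1Hom_resH1Hom, resH1Hom_resH1Hom]
    exact congrFun (congrArg DFunLike.coe (resH1Hom_congr hG hM _ _)) x
  -- conclude by the trace-one corestriction in the subgroup model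
  have hξ : conjH1 (galRange (K := ℚ) K) (geomPoints W) (liftToAbsGal (K := ℚ) K σ) (Φ s) = Φ s := by
    rw [← hΦconj, hs]
  obtain ⟨η, hη⟩ := exists_resSubgroupH1_eq_of_conjH1_eq_cm W K hj h2 hθ hσ1 hξ
  refine ⟨η, ?_⟩
  have e1 : Φ (resBaseChange W K η) = Φ s := by rw [hΦres, hη]
  calc resBaseChange W K η = Ψ (Φ (resBaseChange W K η)) := (hΨΦ _).symm
    _ = Ψ (Φ s) := by rw [e1]
    _ = s := hΨΦ s

/-- **`res(H¹(ℚ, E)) = H¹(K, E_K)^{τ}`** for `j = −3375`, `[K:ℚ] = 2`, `θ² = −7`, `σ ≠ 1`, `τ = liftAut σ` (set form; the inclusion `⊆` is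
`conjH1Points_resBaseChange`). [cite: SerreGaloisCohomology1997, I.§2.4 (Prop. 9 and Cor.) and I.§5.8] [cite: GrossLMS1991, §5 (5.1)] -/
theorem range_resBaseChange_eq_cm (hj : W.j = -3375) (h2 : Module.finrank ℚ K = 2) {θ : K} (hθ : θ ^ 2 = -7)
    {σ : K ≃ₐ[ℚ] K} (hσ1 : σ ≠ 1) :
    ((resBaseChange W K).range : Set (W.baseChange K).galH1) =
      {s | (isLiftOfAut_liftAut σ).conjH1Points W s = s} := by
  ext s
  simp only [SetLike.mem_coe, AddMonoidHom.mem_range, Set.mem_setOf_eq]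
  constructor
  · rintro ⟨c, rfl⟩
    exact conjH1Points_resBaseChange W K (isLiftOfAut_liftAut σ) c
  · exact fun hs ↦ exists_resBaseChange_eq_of_conjH1Points_eq_cm K W hj h2 hθ hσ1 hs

/-- **`res : H¹(ℚ, E) ⥲ H¹(K, E_K)^{τ}` IS A BIJECTION** (`j = −3375`, `K = ℚ(√−7)`, `τ = liftAut σ` for the non-trivial `σ`): every
`τ_*`-invariant class of `H¹(K, E_K)` has EXACTLY ONE preimage in `H¹(ℚ, E)` (existence: `exists_resBaseChange_eq_of_conjH1Points_eq_cm`;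
uniqueness: B6c `resBaseChange_injective_of_cm`). The exact `C₂`-descent of `H¹` at `p = 2 = [K:ℚ]` for the CM class — what remains
for `Ш` is only the local descent. [cite: GrossLMS1991, §5 (5.1)] [cite: SerreGaloisCohomology1997, I.§2.4 (Prop. 9 and Cor.) and I.§5.8] -/
theorem existsUnique_resBaseChange_eq_of_conjH1Points_eq_cm (hj : W.j = -3375) (h2 : Module.finrank ℚ K = 2) {θ : K}
    (hθ : θ ^ 2 = -7) {σ : K ≃ₐ[ℚ] K} (hσ1 : σ ≠ 1) {s : (W.baseChange K).galH1}
    (hs : (isLiftOfAut_liftAut σ).conjH1Points W s = s) :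
    ∃! c : W.galH1, resBaseChange W K c = s := by
  obtain ⟨c, hc⟩ := exists_resBaseChange_eq_of_conjH1Points_eq_cm K W hj h2 hθ hσ1 hs
  exact ⟨c, hc, fun c' hc' ↦ resBaseChange_injective_of_cm W K hj h2 hθ hσ1 (hc'.trans hc.symm)⟩

/-- **Any lift**: the fixed classes of `τ'_*` for ANY lift `τ'` of the non-trivial `σ` are restrictions (`τ_*` does not depend on the lift,
`SylvesterTwoShaConjugation.conjH1Points_eq`). [cite: GrossLMS1991, §5 (5.1)] -/
theorem exists_resBaseChange_eq_of_conjH1Points_eq_cm' (hj : W.j = -3375) (h2 : Module.finrank ℚ K = 2) {θ : K}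
    (hθ : θ ^ 2 = -7) {σ : K ≃ₐ[ℚ] K} (hσ1 : σ ≠ 1) {τ' : AlgebraicClosure K ≃+* AlgebraicClosure K} (hτ' : IsLiftOfAut σ τ')
    {s : (W.baseChange K).galH1} (hs : hτ'.conjH1Points W s = s) :
    ∃ c : W.galH1, resBaseChange W K c = s := by
  rw [SylvesterTwoShaConjugation.conjH1Points_eq W hτ' (isLiftOfAut_liftAut σ)] at hs
  exact exists_resBaseChange_eq_of_conjH1Points_eq_cm K W hj h2 hθ hσ1 hs

end Transport

end Summit.BirchSwinnertonDyer.BirchSwinnertonDyer.Theorems.PrintCf2.CMPrimes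

end
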